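import Mathlib
import HarnessLib

/-!
# Strongly recurrent linear phases are major-arc (Green–Tao 2012, Lemma 3.2), explicit form

Support file (everything PROVED; no definitions, no named facts) towards the named fact
`Literature.NumberTheory.Sieve.teravainen2024_cor_2_1` (J. Teräväinen, *On the Liouville function
at polynomial arguments*, Amer. J. Math. 146 (2024) = arXiv:2010.07924, Corollary 2.1 ⊂
Theorem 2.6, proved in §5). The minor-arc case of Proposition 5.4 there (§5.4, Lemma 5.6) uses
"standard estimates for Weyl sums (see [Green–Tao, *The quantitative behaviour of polynomial
orbits on nilmanifolds*, Ann. of Math. 175 (2012)])", i.e. the quantitative Weyl dichotomy of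
loc. cit. §4 (Proposition 4.3, Lemmas 4.4–4.5), whose basic input is the linear recurrence lemma

> **[GT12, Lemma 3.2]** (Strongly recurrent linear functions are highly non-diophantine). Let
> `α ∈ ℝ`, `0 < δ < 1/2`, and `0 < ε ≤ δ/2`, and let `I ⊆ ℝ/ℤ` be an interval of length `ε` such
> that `αn ∈ I` for at least `δN` values of `n ∈ [N]`. Then there is some `k ∈ ℤ` with
> `0 < |k| ≪ δ^{-O(1)}` such that `‖kα‖_{ℝ/ℤ} ≪ ε δ^{-O(1)}/N`.

This file proves the lemma for the interval `I = [-ε, ε]` (the case needed for Weyl sums) with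
explicit constants and by an elementary counting argument (GT deduce it from their quantitative
Kronecker theorem, Proposition 3.1): writing `‖x‖ = |x - round x|` for the distance to `ℤ`,

* `Teravainen2024.exists_denominator_of_recurrent_linear` — if `0 < δ ≤ 1`, `0 < ε ≤ δ/32`,
  `N ≥ 24/δ²` and `‖nα‖ ≤ ε` for at least `δN` integers `n ∈ [1, N]`, then there is
  `1 ≤ q ≤ 2/δ` with `‖qα‖ ≤ 48 ε/(δ² N)`.

Proof: two of the `≥ δN` good `n` are `≤ 2/δ` apart (pigeonhole), giving `q ≤ 2/δ` with
`β := ‖qα‖ ≤ 2ε`; if `β` were `> 48ε/(δ²N)`, then along each residue class mod `q` the phase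
`nα` moves by `±β` per step, so the good `n` in a class occupy `≤ 2(N/q)β + 3` clusters of
`≤ 2ε/β + 1` consecutive terms, and summing over the `q` classes bounds the number of good `n` by
`8Nε + 6qε/β + 3q < δN`, a contradiction.

## References
* B. Green, T. Tao, *The quantitative behaviour of polynomial orbits on nilmanifolds*, Ann. of
  Math. 175 (2012), 465–540, Lemma 3.2 (arXiv:0709.3562, §3). [GreenTao2012Nilmanifolds]
* J. Teräväinen, Amer. J. Math. 146 (2024), §5.4, proof of Lemma 5.6 ("standard estimates for
  Weyl sums (see [GT12])"). [Teravainen2024]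
-/

noncomputable section

open Finset

namespace Literature.NumberTheory.Sieve

namespace Teravainen2024

/-! ### The distance to the nearest integer, `‖x‖ = |x - round x|` -/

/-- `‖x + y‖ ≤ ‖x‖ + ‖y‖`. [folklore] -/
theorem abs_sub_round_add_le (x y : ℝ) :
    |x + y - round (x + y)| ≤ |x - round x| + |y - round y| := by
  calc |x + y - round (x + y)| ≤ |x + y - ((round x + round y : ℤ) : ℝ)| := round_le _ _
    _ = |(x - round x) + (y - round y)| := by push_cast; ring_nf
    _ ≤ |x - round x| + |y - round y| := abs_add_le _ _

/-- `‖-x‖ = ‖x‖`. [folklore] -/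
theorem abs_sub_round_neg (x : ℝ) : |(-x) - round (-x)| = |x - round x| := by
  apply le_antisymm
  · calc |(-x) - round (-x)| ≤ |(-x) - ((-round x : ℤ) : ℝ)| := round_le _ _
      _ = |x - round x| := by
          push_cast
          rw [show -x - -(round x : ℝ) = -(x - round x) by ring, abs_neg]
  · calc |x - round x| ≤ |x - ((-round (-x) : ℤ) : ℝ)| := round_le _ _
      _ = |(-x) - round (-x)| := by
          push_cast
          rw [show x - -(round (-x) : ℝ) = -((-x) - round (-x)) by ring, abs_neg]

/-- `‖x - y‖ ≤ ‖x‖ + ‖y‖`. [folklore] -/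
theorem abs_sub_round_sub_le (x y : ℝ) :
    |x - y - round (x - y)| ≤ |x - round x| + |y - round y| := by
  have h := abs_sub_round_add_le x (-y)
  rw [abs_sub_round_neg] at h
  simpa [sub_eq_add_neg] using h

/-- `‖x + k‖ = ‖x‖` for an integer `k`. [folklore] -/
theorem abs_sub_round_add_int (x : ℝ) (k : ℤ) : |x + k - round (x + k)| = |x - round x| := by
  rw [round_add_intCast]
  push_cast
  ring_nf

/-- `|x - y| ≤ ‖x‖ + ‖y‖ + |round x - round y|`; in particular two reals with the same nearest
integer are within `‖x‖ + ‖y‖` of each other. [folklore] -/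
theorem abs_sub_le_of_round_eq {x y : ℝ} (h : round x = round y) :
    |x - y| ≤ |x - round x| + |y - round y| := by
  calc |x - y| = |(x - round x) - (y - round y)| := by rw [h]; ring_nf
    _ ≤ |x - round x| + |y - round y| := abs_sub _ _

/-! ### Pigeonhole: a dense set of integers contains two close elements -/

/-- If `S ⊆ [1, N]` has more than `(N-1)/(L+1) + 1` elements, two of them differ by at most `L`
(and are distinct). [folklore] -/
theorem exists_close_pair {N L : ℕ} {S : Finset ℕ} (hS : S ⊆ Icc 1 N)
    (hcard : (N - 1) / (L + 1) + 1 < #S) :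
    ∃ n ∈ S, ∃ n' ∈ S, n < n' ∧ n' - n ≤ L := by
  -- the block map `n ↦ (n-1)/(L+1)` cannot be injective on `S`
  have hmaps : ∀ n ∈ S, (n - 1) / (L + 1) ∈ range ((N - 1) / (L + 1) + 1) := by
    intro n hn
    have h := hS hn
    rw [Finset.mem_Icc] at h
    rw [Finset.mem_range, Nat.lt_add_one_iff]
    exact Nat.div_le_div_right (by omega)
  have hlt : #(range ((N - 1) / (L + 1) + 1)) < #S := by rwa [Finset.card_range]
  obtain ⟨n, hn, n', hn', hne, hf⟩ := Finset.exists_ne_map_eq_of_card_lt_of_maps_to hlt hmaps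
  -- same block ⟹ distance `≤ L`
  have hclose : ∀ a b : ℕ, 1 ≤ a → (a - 1) / (L + 1) = (b - 1) / (L + 1) → a < b →
      b - a ≤ L := by
    intro a b ha1 hab hlt'
    have h1 := Nat.div_add_mod (a - 1) (L + 1)
    have h2 := Nat.div_add_mod (b - 1) (L + 1)
    rw [hab] at h1
    have h3 := Nat.mod_lt (a - 1) (show 0 < L + 1 by omega)
    have h4 := Nat.mod_lt (b - 1) (show 0 < L + 1 by omega)
    generalize (L + 1) * ((b - 1) / (L + 1)) = B at h1 h2
    omega
  have hn1 : 1 ≤ n := (Finset.mem_Icc.mp (hS hn)).1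
  have hn'1 : 1 ≤ n' := (Finset.mem_Icc.mp (hS hn')).1
  rcases lt_or_gt_of_ne hne with h | h
  · exact ⟨n, hn, n', hn', h, hclose n n' hn1 hf h⟩
  · exact ⟨n', hn', n, hn, h, hclose n' n hn'1 hf.symm h⟩

/-! ### Counting integers with a prescribed nearest-integer pattern along a progression -/

/-- Along `s ↦ sθ + c` (`|θ| = β > 0`), the integers `s ∈ [0, S]` with `‖sθ + c‖ ≤ ε` number at
most `(2Sβ + 3)(2ε/β + 1)`: the nearest integer of `sθ + c` takes `≤ 2Sβ + 3` values, and two `s`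
with the same nearest integer and `‖·‖ ≤ ε` are `≤ 2ε/β` apart. [folklore] -/
theorem card_filter_abs_sub_round_le {θ c ε : ℝ} (hθ : θ ≠ 0) (hε : 0 ≤ ε) (S : ℕ) :
    (#((Icc 0 S).filter fun s : ℕ => |s * θ + c - round (s * θ + c)| ≤ ε) : ℝ) ≤
      (2 * S * |θ| + 3) * (2 * ε / |θ| + 1) := by
  classical
  set β : ℝ := |θ| with hβ
  have hβ0 : 0 < β := abs_pos.mpr hθ
  set T : Finset ℕ := (Icc 0 S).filter fun s : ℕ => |s * θ + c - round (s * θ + c)| ≤ ε with hT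
  set f : ℕ → ℤ := fun s => round (s * θ + c) with hf
  -- fibres of the nearest-integer map are short
  have hfib : ∀ v ∈ T.image f, #(T.filter fun s => f s = v) ≤ ⌊2 * ε / β⌋₊ + 1 := by
    intro v hv
    set F : Finset ℕ := T.filter fun s => f s = v with hF
    have hFne : F.Nonempty := by
      rw [Finset.mem_image] at hv
      obtain ⟨s, hs, hsv⟩ := hv
      exact ⟨s, Finset.mem_filter.mpr ⟨hs, hsv⟩⟩
    set s₀ : ℕ := F.min' hFne with hs₀
    have hs₀mem : s₀ ∈ F := Finset.min'_mem F hFne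
    have hsub : F ⊆ Icc s₀ (s₀ + ⌊2 * ε / β⌋₊) := by
      intro s hs
      have hmin : s₀ ≤ s := Finset.min'_le F s hs
      rw [Finset.mem_Icc]
      refine ⟨hmin, ?_⟩
      -- `|sθ - s₀θ| ≤ 2ε`
      have hs' := Finset.mem_filter.mp hs
      have hs₀' := Finset.mem_filter.mp hs₀mem
      have hsT := Finset.mem_filter.mp hs'.1
      have hs₀T := Finset.mem_filter.mp hs₀'.1
      have hround : round ((s : ℝ) * θ + c) = round ((s₀ : ℝ) * θ + c) := by
        have h1 : f s = v := hs'.2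
        have h2 : f s₀ = v := hs₀'.2
        simp only [hf] at h1 h2
        rw [h1, h2]
      have hdiff := abs_sub_le_of_round_eq hround
      have hd : |((s : ℝ) - s₀) * θ| ≤ 2 * ε := by
        have e : (s : ℝ) * θ + c - ((s₀ : ℝ) * θ + c) = ((s : ℝ) - s₀) * θ := by ring
        rw [← e]
        linarith [hsT.2, hs₀T.2]
      rw [abs_mul, ← hβ] at hd
      have hsd : (s : ℝ) - s₀ ≤ 2 * ε / β := by
        rw [le_div_iff₀ hβ0]
        have : (s : ℝ) - s₀ ≤ |(s : ℝ) - s₀| := le_abs_self _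
        nlinarith
      have hsd' : ((s - s₀ : ℕ) : ℝ) ≤ 2 * ε / β := by
        rw [Nat.cast_sub hmin]
        exact hsd
      have := Nat.le_floor hsd'
      omega
    calc #F ≤ #(Icc s₀ (s₀ + ⌊2 * ε / β⌋₊)) := Finset.card_le_card hsub
      _ = ⌊2 * ε / β⌋₊ + 1 := by
          rw [Nat.card_Icc]
          omega
  -- the nearest-integer map takes few values
  have himg : (#(T.image f) : ℝ) ≤ 2 * S * β + 3 := by
    have hsub : T.image f ⊆ Finset.Icc ⌊c - S * β⌋ ⌈c + S * β⌉ := by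
      intro v hv
      rw [Finset.mem_image] at hv
      obtain ⟨s, hs, rfl⟩ := hv
      have hsT := Finset.mem_filter.mp hs
      have hsS : (s : ℝ) ≤ S := by exact_mod_cast (Finset.mem_Icc.mp hsT.1).2
      have hs0 : (0 : ℝ) ≤ s := Nat.cast_nonneg s
      have hsθ : |(s : ℝ) * θ| ≤ S * β := by
        rw [abs_mul, ← hβ, abs_of_nonneg hs0]
        exact mul_le_mul_of_nonneg_right hsS hβ0.le
      rw [abs_le] at hsθ
      rw [Finset.mem_Icc]
      simp only [hf]
      constructor
      · -- `⌊c - Sβ⌋ ≤ round (sθ + c)`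
        rw [round_eq]
        exact Int.floor_le_floor (by linarith)
      · -- `round (sθ + c) ≤ ⌈c + Sβ⌉`
        rw [round_eq]
        have h1 : (s : ℝ) * θ + c + 1 / 2 < ⌈c + S * β⌉ + 1 := by
          linarith [Int.le_ceil (c + S * β)]
        have h2 : ⌊(s : ℝ) * θ + c + 1 / 2⌋ < ⌈c + S * β⌉ + 1 := by
          rw [Int.floor_lt]
          push_cast
          exact h1
        omega
    calc (#(T.image f) : ℝ) ≤ #(Finset.Icc ⌊c - S * β⌋ ⌈c + S * β⌉) := by
          exact_mod_cast Finset.card_le_card hsub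
      _ ≤ 2 * S * β + 3 := by
          rw [Int.card_Icc]
          have h1 : ((⌈c + S * β⌉ + 1 - ⌊c - S * β⌋).toNat : ℝ) ≤
              ((⌈c + ↑S * β⌉ : ℝ) + 1 - (⌊c - ↑S * β⌋ : ℝ)) := by
            have hnn : 0 ≤ ⌈c + S * β⌉ + 1 - ⌊c - S * β⌋ := by
              have : ⌊c - S * β⌋ ≤ ⌈c + S * β⌉ := by
                have h3 : ⌊c - S * β⌋ ≤ ⌊c + S * β⌋ :=
                  Int.floor_le_floor (by nlinarith [hβ0, Nat.cast_nonneg (α := ℝ) S])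
                exact h3.trans (Int.floor_le_ceil _)
              omega
            have : (((⌈c + S * β⌉ + 1 - ⌊c - S * β⌋).toNat : ℤ) : ℝ) =
                ((⌈c + S * β⌉ + 1 - ⌊c - S * β⌋ : ℤ) : ℝ) := by
              rw [Int.toNat_of_nonneg hnn]
            rw [← Int.cast_natCast, this]
            push_cast
            exact le_rfl
          refine h1.trans ?_
          have h2 := Int.ceil_lt_add_one (c + S * β)
          have h3 := Int.lt_floor_add_one (c - S * β)
          linarith
  -- combine
  have hmul := Finset.card_le_mul_card_image_of_maps_to (s := T) (t := T.image f) (f := f)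
    (fun s hs => Finset.mem_image_of_mem f hs) (⌊2 * ε / β⌋₊ + 1) hfib
  calc (#T : ℝ) ≤ ((⌊2 * ε / β⌋₊ + 1 : ℕ) : ℝ) * #(T.image f) := by exact_mod_cast hmul
    _ ≤ (2 * ε / β + 1) * (2 * S * β + 3) := by
        apply mul_le_mul _ himg (Nat.cast_nonneg _) (by positivity)
        push_cast
        linarith [Nat.floor_le (by positivity : 0 ≤ 2 * ε / β)]
    _ = (2 * S * β + 3) * (2 * ε / β + 1) := by ring

/-! ### The lemma, in three steps -/

/-- **Step 1** (pigeonhole): under the hypotheses of the lemma, two good `n` are `≤ 2/δ` apart,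
so some `1 ≤ q ≤ 2/δ` has `‖qα‖ ≤ 2ε`. [cite: GreenTao2012Nilmanifolds, Lemma 3.2 (proof,
variant)] -/
theorem exists_denominator_small_of_recurrent_linear {α δ ε : ℝ} {N : ℕ} (hδ0 : 0 < δ)
    (hδN : 24 ≤ δ * N)
    (hS : δ * N ≤ #((Icc 1 N).filter fun n : ℕ => |n * α - round (n * α)| ≤ ε)) :
    ∃ q : ℕ, 1 ≤ q ∧ (q : ℝ) ≤ 2 / δ ∧ |q * α - round (q * α)| ≤ 2 * ε := by
  classical
  set S : Finset ℕ := (Icc 1 N).filter fun n : ℕ => |n * α - round (n * α)| ≤ ε with hSdef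
  have hSsub : S ⊆ Icc 1 N := Finset.filter_subset _ _
  have hNpos : (0 : ℝ) < N := by
    by_contra h
    rw [not_lt] at h
    nlinarith
  have hN1 : 1 ≤ N := by exact_mod_cast (show (0 : ℝ) < N from hNpos)
  set L : ℕ := ⌊2 / δ⌋₊ with hL
  have hL1 : (2 : ℝ) / δ < L + 1 := Nat.lt_floor_add_one _
  have hcard : (N - 1) / (L + 1) + 1 < #S := by
    have h1 : (((N - 1) / (L + 1) : ℕ) : ℝ) ≤ ((N : ℝ) - 1) / (L + 1) := by
      have := Nat.cast_div_le (α := ℝ) (m := N - 1) (n := L + 1)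
      push_cast [Nat.cast_sub hN1] at this
      exact this
    have h2 : ((N : ℝ) - 1) / (L + 1) < δ * N / 2 := by
      rw [div_lt_iff₀ (by positivity)]
      have h4 : (N : ℝ) = δ * N / 2 * (2 / δ) := by
        field_simp
      calc (N : ℝ) - 1 < N := by linarith
        _ = δ * N / 2 * (2 / δ) := h4
        _ ≤ δ * N / 2 * (L + 1) := mul_le_mul_of_nonneg_left hL1.le (by positivity)
    have h5 : (((N - 1) / (L + 1) + 1 : ℕ) : ℝ) < #S := by
      push_cast
      linarith
    exact_mod_cast h5
  obtain ⟨n, hn, n', hn', hnn', hq⟩ := exists_close_pair hSsub hcard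
  have hnS := (Finset.mem_filter.mp hn).2
  have hn'S := (Finset.mem_filter.mp hn').2
  refine ⟨n' - n, by omega, ?_, ?_⟩
  · calc ((n' - n : ℕ) : ℝ) ≤ L := by exact_mod_cast hq
      _ ≤ 2 / δ := Nat.floor_le (by positivity)
  · have e : ((n' - n : ℕ) : ℝ) * α = (n' : ℝ) * α - (n : ℝ) * α := by
      rw [Nat.cast_sub hnn'.le]
      ring
    rw [e]
    linarith [abs_sub_round_sub_le ((n' : ℝ) * α) ((n : ℝ) * α)]

/-- **Step 2** (counting along residue classes): for `q ≥ 1` with `θ := qα - round(qα) ≠ 0`, the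
number of `n ∈ [1, N]` with `‖nα‖ ≤ ε` is at most `q (2(N/q)|θ| + 3)(2ε/|θ| + 1)`.
[cite: GreenTao2012Nilmanifolds, Lemma 3.2 (proof, variant)] -/
theorem card_recurrent_le_of_denominator {α ε : ℝ} (hε : 0 ≤ ε) {N q : ℕ} (hq : 1 ≤ q)
    (hθ : (q : ℝ) * α - round ((q : ℝ) * α) ≠ 0) :
    (#((Icc 1 N).filter fun n : ℕ => |n * α - round (n * α)| ≤ ε) : ℝ) ≤
      q * ((2 * ((N / q : ℕ) : ℝ) * |(q : ℝ) * α - round ((q : ℝ) * α)| + 3) *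
        (2 * ε / |(q : ℝ) * α - round ((q : ℝ) * α)| + 1)) := by
  classical
  set S : Finset ℕ := (Icc 1 N).filter fun n : ℕ => |n * α - round (n * α)| ≤ ε with hSdef
  set m : ℤ := round ((q : ℝ) * α) with hm
  set θ : ℝ := (q : ℝ) * α - m with hθdef
  have hfib : ∀ r ∈ range q, (#(S.filter fun n => n % q = r) : ℝ) ≤
      (2 * ((N / q : ℕ) : ℝ) * |θ| + 3) * (2 * ε / |θ| + 1) := by
    intro r _
    have hinj : Set.InjOn (fun n : ℕ => n / q) (S.filter fun n => n % q = r) := by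
      intro a ha b hb hab
      have ha' := (Finset.mem_filter.mp ha).2
      have hb' := (Finset.mem_filter.mp hb).2
      have h1 := Nat.div_add_mod a q
      have h2 := Nat.div_add_mod b q
      simp only at hab
      rw [hab] at h1
      have h3 : a % q = b % q := by rw [ha', hb']
      rw [h3] at h1
      generalize q * (b / q) = B at h1 h2
      omega
    have hmaps : ∀ a ∈ S.filter (fun n => n % q = r),
        a / q ∈ (Icc 0 (N / q)).filter fun s : ℕ => |s * θ + r * α - round (s * θ + r * α)| ≤ ε := by
      intro a ha
      obtain ⟨haS, har⟩ := Finset.mem_filter.mp ha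
      obtain ⟨haI, hagood⟩ := Finset.mem_filter.mp haS
      have haN := (Finset.mem_Icc.mp haI).2
      rw [Finset.mem_filter, Finset.mem_Icc]
      refine ⟨⟨Nat.zero_le _, Nat.div_le_div_right haN⟩, ?_⟩
      have hdecomp : (a : ℝ) * α =
          ((a / q : ℕ) : ℝ) * θ + r * α + ((((a / q : ℕ) : ℤ) * m : ℤ) : ℝ) := by
        have h := Nat.div_add_mod a q
        rw [har] at h
        have h' : (a : ℝ) = q * ((a / q : ℕ) : ℝ) + r := by exact_mod_cast h.symm
        rw [h', hθdef]
        simp only [Int.cast_mul, Int.cast_natCast]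
        ring
      rw [hdecomp, abs_sub_round_add_int] at hagood
      exact hagood
    calc (#(S.filter fun n => n % q = r) : ℝ)
        ≤ #((Icc 0 (N / q)).filter fun s : ℕ => |s * θ + r * α - round (s * θ + r * α)| ≤ ε) := by
          exact_mod_cast Finset.card_le_card_of_injOn _ hmaps hinj
      _ ≤ (2 * ((N / q : ℕ) : ℝ) * |θ| + 3) * (2 * ε / |θ| + 1) :=
          card_filter_abs_sub_round_le hθ hε (N / q)
  have h := Finset.card_eq_sum_card_fiberwise (f := fun n : ℕ => n % q) (s := S) (t := range q)
    (fun n _ => Finset.mem_range.mpr (Nat.mod_lt n (by omega)))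
  rw [h]
  push_cast
  calc ∑ r ∈ range q, (#(S.filter fun n => n % q = r) : ℝ)
      ≤ ∑ r ∈ range q, (2 * ((N / q : ℕ) : ℝ) * |θ| + 3) * (2 * ε / |θ| + 1) :=
        Finset.sum_le_sum hfib
    _ = q * ((2 * ((N / q : ℕ) : ℝ) * |θ| + 3) * (2 * ε / |θ| + 1)) := by
        rw [Finset.sum_const, Finset.card_range, nsmul_eq_mul]

/-- **Step 3** (arithmetic): with `qM ≤ N`, `1 ≤ q ≤ 2/δ`, `0 < β ≤ 2ε`, `ε ≤ δ/32`,
`N ≥ 24/δ²` and `β > 48ε/(δ²N)`, the count `q(2Mβ + 3)(2ε/β + 1)` is `< δN`. [folklore] -/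
theorem recurrent_count_lt {δ ε β M N q : ℝ} (hδ0 : 0 < δ) (hδ1 : δ ≤ 1) (hε0 : 0 < ε)
    (hεδ : ε ≤ δ / 32) (hN : 24 / δ ^ 2 ≤ N) (hq1 : 1 ≤ q) (hqδ : q ≤ 2 / δ)
    (hqM : q * M ≤ N) (hβ0 : 0 < β) (hβε : β ≤ 2 * ε) (hβ : 48 * ε / (δ ^ 2 * N) < β) :
    q * ((2 * M * β + 3) * (2 * ε / β + 1)) < δ * N := by
  have hδ2 : 0 < δ ^ 2 := by positivity
  have hδ2N : 24 ≤ δ ^ 2 * N := by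
    have := mul_le_mul_of_nonneg_left hN hδ2.le
    rwa [mul_div_cancel₀ _ hδ2.ne'] at this
  have hNpos : 0 < N := by nlinarith
  have h1 : q * ((2 * M * β + 3) * (2 * ε / β + 1)) =
      4 * ε * (q * M) + 2 * β * (q * M) + 6 * q * ε / β + 3 * q := by
    field_simp
    ring
  rw [h1]
  have hA : 4 * ε * (q * M) + 2 * β * (q * M) ≤ δ * N / 4 := by
    have h2 : 4 * ε * (q * M) ≤ 4 * ε * N := mul_le_mul_of_nonneg_left hqM (by positivity)
    have h3 : 2 * β * (q * M) ≤ 2 * β * N := mul_le_mul_of_nonneg_left hqM (by positivity)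
    have h4 : 2 * β * N ≤ 4 * ε * N := by nlinarith
    have h5 : 8 * ε * N ≤ δ * N / 4 := by nlinarith
    linarith
  have hB : 3 * q ≤ δ * N / 4 := by
    have h2 : 3 * q ≤ 6 / δ := by
      calc 3 * q ≤ 3 * (2 / δ) := by linarith
        _ = 6 / δ := by ring
    have h3 : 6 / δ ≤ δ * N / 4 := by
      rw [div_le_div_iff₀ hδ0 (by norm_num : (0 : ℝ) < 4)]
      nlinarith
    linarith
  have hC : 6 * q * ε / β < δ * N / 4 := by
    rw [div_lt_iff₀ hβ0]
    have h2 : 48 * ε / (δ ^ 2 * N) * (δ * N / 4) < β * (δ * N / 4) :=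
      mul_lt_mul_of_pos_right hβ (by positivity)
    have h3 : 48 * ε / (δ ^ 2 * N) * (δ * N / 4) = 12 * ε / δ := by
      field_simp
      ring
    rw [h3] at h2
    have h4 : 6 * q * ε ≤ 12 * ε / δ := by
      calc 6 * q * ε ≤ 6 * (2 / δ) * ε := by nlinarith
        _ = 12 * ε / δ := by ring
    linarith
  nlinarith

/-- **Green–Tao 2012, Lemma 3.2 (strongly recurrent linear phases are major-arc), explicit
form.** Let `0 < δ ≤ 1`, `0 < ε ≤ δ/32`, `N ≥ 24/δ²`, and suppose that `‖nα‖ ≤ ε` for at least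
`δN` integers `n ∈ [1, N]` (`‖x‖ = |x - round x|`). Then there is `1 ≤ q ≤ 2/δ` with
`‖qα‖ ≤ 48 ε / (δ² N)`. [cite: GreenTao2012Nilmanifolds, Lemma 3.2 (explicit variant)]
[cite: Teravainen2024, §5.4 (Lemma 5.6, "standard estimates for Weyl sums")] -/
theorem exists_denominator_of_recurrent_linear {α δ ε : ℝ} {N : ℕ} (hδ0 : 0 < δ) (hδ1 : δ ≤ 1)
    (hε0 : 0 < ε) (hεδ : ε ≤ δ / 32) (hN : 24 / δ ^ 2 ≤ N)
    (hS : δ * N ≤ #((Icc 1 N).filter fun n : ℕ => |n * α - round (n * α)| ≤ ε)) :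
    ∃ q : ℕ, 1 ≤ q ∧ (q : ℝ) ≤ 2 / δ ∧ |q * α - round (q * α)| ≤ 48 * ε / (δ ^ 2 * N) := by
  -- `δ N ≥ 24`
  have hδ2 : 0 < δ ^ 2 := by positivity
  have hδ2N : 24 ≤ δ ^ 2 * (N : ℝ) := by
    have := mul_le_mul_of_nonneg_left hN hδ2.le
    rwa [mul_div_cancel₀ _ hδ2.ne'] at this
  have hδN : 24 ≤ δ * N := by
    have hNnn : (0 : ℝ) ≤ N := Nat.cast_nonneg N
    nlinarith [mul_le_mul_of_nonneg_right hδ1 (mul_nonneg hδ0.le hNnn)]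
  obtain ⟨q, hq1, hqδ, hqα⟩ := exists_denominator_small_of_recurrent_linear hδ0 hδN hS
  refine ⟨q, hq1, hqδ, ?_⟩
  by_contra hcon
  rw [not_le] at hcon
  have hβpos : 0 < |(q : ℝ) * α - round ((q : ℝ) * α)| := lt_of_le_of_lt (by positivity) hcon
  have hθ0 : (q : ℝ) * α - round ((q : ℝ) * α) ≠ 0 := abs_pos.mp hβpos
  have hcount := card_recurrent_le_of_denominator (N := N) hε0.le hq1 hθ0
  have hqM : (q : ℝ) * ((N / q : ℕ) : ℝ) ≤ N := by exact_mod_cast Nat.mul_div_le N q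
  have hlt := recurrent_count_lt hδ0 hδ1 hε0 hεδ hN (by exact_mod_cast hq1) hqδ
    hqM hβpos hqα hcon
  linarith

end Teravainen2024

end Literature.NumberTheory.Sieve
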